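import Literature.NumberTheory.GaloisRepresentations.IdeleClassGroupLimitLayers
import Literature.NumberTheory.GaloisRepresentations.RestrictedRamificationOpenSubgroupLayers
import HarnessLib

/-!
# `C_{K_S} = C̄^{N_S} = ⋃_{E ⊆ K_S} C_E`: the idèle classes of `K_S` as a discrete `G_S = Gal(K_S/K)`-module
# (Milne ADT I §4 "`C_S = lim→ C_F`", the layers `C_F`, `F ⊆ K_S`; NSW (8.3.7); Harari Thm. 17.2, proof)

Topic `NumberTheory/GaloisRepresentations`; namespace `Literature.NumberTheory.GaloisRepresentations.IdeleClassBar`.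
Sequel to door-c5's `IdeleClassGroupLimit*.lean` (`GalLayer K`, `classBar K = C̄ = lim→_E C_E`, `ofLayer`, `barRep`,
`classBarD K : DiscreteRepCat ℤ Γ_K`, `exists_ofLayer_eq_of_forall_mem_fixingSubgroup` = `H⁰(Gal(K̄/E), C̄) = C_E`) and to
the lane's `RestrictedRamificationOpenSubgroupLayers.lean` (`ramificationSubgroup K S ≤ galFixing K E` = «`E ⊆ K_S`»).
Definitions with bodies and theorems; NO named fact, no `sorry`, no instance, no notation; number fields in `Type`.
Cell `bsd-eis`, background lane «PT-Ш-S-TC» (Poitou–Tate duality with restricted ramification from Tate's duality theorem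
for the `P`-class formation `(G_S, C̄_S)`), brick D1-(ii) part 1 — the object `C_{K_S}`; the quotient `C̄_S = C_{K_S} ⧸ Ū_S`
is the sequel `IdeleClassBarS.lean`.  Written `--supports` crux `GoodLatticeBDPValue` (stmt-BirchSwinnertonDyer-19032).
HONEST FRAMING: definitions and bookkeeping of classical objects; no duality theorem, no case of BSD is proved here.

Mathematics (Milne, *Arithmetic Duality Theorems* I §4 (p. 55); Neukirch–Schmidt–Wingberg (8.3.7); Harari, proof of
Thm. 17.2 (p. 289), where the `G_S`-module `C^{H_S} = C(k_S)` appears).  `K` a number field, `S` a finite set of finite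
places, `N_S ≤ Γ_K` the ramification subgroup outside `S` (`ramificationSubgroup K S`), `K_S = K̄^{N_S}`,
`G_S = Γ_K ⧸ N_S` (`GaloisGroupUnramifiedOutside K S`).  A finite Galois layer `E ⊆ K̄` lies INSIDE `K_S` iff
`N_S ≤ Gal(K̄/E)` (`ramificationSubgroup K S ≤ galFixing K E`, the lane's currency).  Define **`C_{K_S} := C̄^{N_S}`**, the
`N_S`-invariants of the discrete `Γ_K`-module `C̄ = lim→_E C_E`, with the induced action of `G_S` (door-c4's
`invariantsQuotFunctor`).  Since every element of `C̄` comes from a layer `C_M` and `C̄^{Gal(K̄/E)} = C_E`: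
**`C̄^{N_S} = ⋃_{E ⊆ K_S} C_E`** — an element of `C_M` fixed by `N_S` is fixed by the open normal subgroup
`Gal(K̄/M) · N_S = Gal(K̄/(M ∩ K_S))`, i.e. comes from the layer `M ∩ K_S ⊆ K_S` (`exists_layer_insideKS_of_forall_mem`).  This
is Milne's `C(K_S) = lim→_{F ⊆ K_S} C_F` (the idèle class group of `K_S`); `Gal(K_S/E)` fixes `C_E` and every stabiliser is
open, so `C_{K_S} ∈ C_{G_S} = DiscreteRepCat ℤ G_S`.

## What is formalised (`K : Type` a number field, `S : Finset (HeightOneSpectrum (𝓞 K))`, `N = ramificationSubgroup K ↑S`)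

* §1 layers inside `K_S`: `mem_galFixing_iff_mem_fixingSubgroup`, `galFixing_eq_coe_openNormalSubgroup`, `insideKS_bot`,
  `insideKS_sup`, `exists_ge_ge_insideKS`, `insideKS_of_le`, `barRep_ofLayer_of_mem_ramificationSubgroup`,
  **`exists_layer_insideKS_of_forall_mem`** (`C̄^{N_S} ⊆ ⋃_{E ⊆ K_S} C_E`).
* §2 **`classBarKS K S : Rep ℤ (GaloisGroupUnramifiedOutside K ↑S)`** (`= C̄^{N_S}`), `mem_invariantsKS_iff_forall`,
  **`mem_invariantsKS_iff`**, `coe_classBarKS_ρ_mk`, **`toKS hE : C_E →+ C_{K_S}`** (+ `coe_toKS`, `toKS_injective`,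
  `toKS_transHom`, **`exists_toKS`**, `classBarKS_ρ_mk_toKS`, **`classBarKS_ρ_mk_toKS_of_mem`**), `isOpen_map_galFixing`,
  `map_galFixing_le_stabilizer_toKS`, **`isDiscrete_classBarKS`**, **`classBarKSD K S : DiscreteRepCat ℤ G_S`**.

## References
* J. S. Milne, *Arithmetic Duality Theorems*, 2nd ed. (2006), I §4 (p. 55: `C_S = lim→ C_F` over `F ⊆ K_S`). [MilneADT2006]
* J. Neukirch, A. Schmidt, K. Wingberg, *Cohomology of Number Fields*, 2nd ed. (2008), VIII §3 (8.3.7). [NeukirchSchmidtWingberg2008]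
* D. Harari, *Galois Cohomology and Class Field Theory*, Universitext (2020), §17.1 Thm. 17.2 (proof, p. 289). [Harari2020]
-/

noncomputable section

open NumberField IsDedekindDomain CategoryTheory
open Field (absoluteGaloisGroup)
open Literature.NumberTheory.Automorphic Literature.NumberTheory.Automorphic.IdeleClassGroup
open Literature.NumberTheory.NumberFields
open Literature.Algebra.Homology
open Literature.NumberTheory.GaloisRepresentations.LocalWeilDatum (galFixing mem_galFixing_iff isOpen_galFixing
  galFixing_antitone galFixing_sup)
open scoped Classical

namespace Literature.NumberTheory.GaloisRepresentations

namespace IdeleClassBar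

variable {K : Type} [Field K] [NumberField K] (S : Finset (HeightOneSpectrum (𝓞 K)))

/-! ## §1. Layers inside `K_S` -/

omit [NumberField K] in
/-- `σ ∈ galFixing K E ↔ σ ∈ Gal(K̄/E)` (the lane's `galFixing` is Mathlib's `fixingSubgroup` read through the identity
`Aut_K(K̄) = Γ_K`; definitional). [cite: NeukirchSchmidtWingberg2008, VIII §3] -/
theorem mem_galFixing_iff_mem_fixingSubgroup (E : GalLayer K) (σ : absoluteGaloisGroup K) :
    σ ∈ galFixing K E.1 ↔ σ ∈ E.1.fixingSubgroup := Iff.rfl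

omit [NumberField K] in
/-- `galFixing K E = U_E` as subgroups of `Γ_K` (definitional). [cite: NeukirchSchmidtWingberg2008, VIII §3] -/
theorem galFixing_eq_coe_openNormalSubgroup (E : GalLayer K) :
    galFixing K E.1 = (E.openNormalSubgroup : Subgroup (absoluteGaloisGroup K)) := rfl

omit [NumberField K] in
/-- The bottom layer `K` lies inside `K_S` (`Gal(K̄/K) = Γ_K`). [cite: NeukirchSchmidtWingberg2008, VIII §3] -/
theorem insideKS_bot : ramificationSubgroup K (↑S : Set (HeightOneSpectrum (𝓞 K))) ≤ galFixing K (GalLayer.bot K).1 :=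
  fun σ _ => (mem_galFixing_iff K).2 fun x hx => by
    obtain ⟨a, rfl⟩ := IntermediateField.mem_bot.1 hx
    exact σ.commutes a

omit [NumberField K] in
/-- **The compositum of two layers inside `K_S` lies inside `K_S`** (`Gal(K̄/EE') = Gal(K̄/E) ∩ Gal(K̄/E')`).
[cite: NeukirchSchmidtWingberg2008, VIII §3] -/
theorem insideKS_sup {E E' : GalLayer K}
    (hE : ramificationSubgroup K (↑S : Set (HeightOneSpectrum (𝓞 K))) ≤ galFixing K E.1)
    (hE' : ramificationSubgroup K (↑S : Set (HeightOneSpectrum (𝓞 K))) ≤ galFixing K E'.1) :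
    ramificationSubgroup K (↑S : Set (HeightOneSpectrum (𝓞 K))) ≤ galFixing K (GalLayer.sup E E').1 := by
  change _ ≤ galFixing K (E.1 ⊔ E'.1)
  rw [galFixing_sup]
  exact le_inf hE hE'

omit [NumberField K] in
/-- The layers inside `K_S` are directed. [cite: NeukirchSchmidtWingberg2008, VIII §3] -/
theorem exists_ge_ge_insideKS {E E' : GalLayer K}
    (hE : ramificationSubgroup K (↑S : Set (HeightOneSpectrum (𝓞 K))) ≤ galFixing K E.1)
    (hE' : ramificationSubgroup K (↑S : Set (HeightOneSpectrum (𝓞 K))) ≤ galFixing K E'.1) :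
    ∃ M : GalLayer K, E ≤ M ∧ E' ≤ M ∧
      ramificationSubgroup K (↑S : Set (HeightOneSpectrum (𝓞 K))) ≤ galFixing K M.1 :=
  ⟨GalLayer.sup E E', le_sup_left (a := E.1) (b := E'.1), le_sup_right (a := E.1) (b := E'.1), insideKS_sup S hE hE'⟩

omit [NumberField K] in
/-- A sublayer of a layer inside `K_S` lies inside `K_S`. [cite: NeukirchSchmidtWingberg2008, VIII §3] -/
theorem insideKS_of_le {E E' : GalLayer K} (h : E ≤ E')
    (hE' : ramificationSubgroup K (↑S : Set (HeightOneSpectrum (𝓞 K))) ≤ galFixing K E'.1) :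
    ramificationSubgroup K (↑S : Set (HeightOneSpectrum (𝓞 K))) ≤ galFixing K E.1 :=
  hE'.trans (galFixing_antitone K h)

/-- **`N_S` fixes the image of `C_E` in `C̄` for `E ⊆ K_S`.** [cite: Harari2020, §17.1 Thm. 17.2 (proof)] -/
theorem barRep_ofLayer_of_mem_ramificationSubgroup {E : GalLayer K}
    (hE : ramificationSubgroup K (↑S : Set (HeightOneSpectrum (𝓞 K))) ≤ galFixing K E.1)
    {σ : absoluteGaloisGroup K} (hσ : σ ∈ ramificationSubgroup K (↑S : Set (HeightOneSpectrum (𝓞 K))))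
    (x : layerClass K E) : barRep K σ (ofLayer K E x) = ofLayer K E x :=
  barRep_ofLayer_of_mem_fixingSubgroup E (hE hσ) x

/-- **An element of `C̄` fixed by `N_S` comes from a layer inside `K_S`**: if `z = [y]_M` is fixed by `N_S`, it is fixed by
the open normal subgroup `U_M ⊔ N_S`, whose layer `K̄^{U_M ⊔ N_S} = M ∩ K_S` lies inside `K_S`; and
`C̄^{Gal(K̄/E)} = C_E` (door-c5 `exists_ofLayer_eq_of_forall_mem_fixingSubgroup`).  So `C̄^{N_S} = ⋃_{E ⊆ K_S} C_E`
(Milne: `C_S`-layers `C_F`, `F ⊆ K_S`). [cite: MilneADT2006, I §4 (p. 55)][cite: NeukirchSchmidtWingberg2008, VIII §3 (8.3.7)] -/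
theorem exists_layer_insideKS_of_forall_mem (z : classBar K)
    (hz : ∀ σ ∈ ramificationSubgroup K (↑S : Set (HeightOneSpectrum (𝓞 K))), barRep K σ z = z) :
    ∃ (E : GalLayer K) (_ : ramificationSubgroup K (↑S : Set (HeightOneSpectrum (𝓞 K))) ≤ galFixing K E.1)
      (x : layerClass K E), ofLayer K E x = z := by
  obtain ⟨M, y, rfl⟩ := exists_ofLayer z
  -- the open normal subgroup `W = U_M ⊔ N_S`
  let W : OpenNormalSubgroup (absoluteGaloisGroup K) :=
    { toSubgroup := (M.openNormalSubgroup : Subgroup (absoluteGaloisGroup K)) ⊔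
          ramificationSubgroup K (↑S : Set (HeightOneSpectrum (𝓞 K)))
      isOpen' := Subgroup.isOpen_mono (le_sup_left (a := (M.openNormalSubgroup : Subgroup (absoluteGaloisGroup K))))
        M.openNormalSubgroup.toOpenSubgroup.isOpen
      isNormal' := Subgroup.sup_normal _ _ }
  have hW : (W : Subgroup (absoluteGaloisGroup K)) =
      (M.openNormalSubgroup : Subgroup (absoluteGaloisGroup K)) ⊔
        ramificationSubgroup K (↑S : Set (HeightOneSpectrum (𝓞 K))) := rfl
  -- its layer `E = K̄^W`, inside `K_S`
  refine ⟨GalLayer.ofOpenNormalSubgroup W, ?_, ?_⟩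
  · rw [galFixing_eq_coe_openNormalSubgroup, GalLayer.openNormalSubgroup_ofOpenNormalSubgroup, hW]
    exact le_sup_right
  · refine exists_ofLayer_eq_of_forall_mem_fixingSubgroup _ _ fun σ hσ => ?_
    have hσ' : σ ∈ ((GalLayer.ofOpenNormalSubgroup W).openNormalSubgroup : Subgroup (absoluteGaloisGroup K)) := hσ
    rw [GalLayer.openNormalSubgroup_ofOpenNormalSubgroup, hW] at hσ'
    -- `W` is generated by `U_M` and `N_S`, both of which lie in the stabiliser of `[y]_M`
    have hle : (M.openNormalSubgroup : Subgroup (absoluteGaloisGroup K)) ⊔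
        ramificationSubgroup K (↑S : Set (HeightOneSpectrum (𝓞 K))) ≤
          DiscreteRep.stabilizer (classBarRep K) (ofLayer K M y) :=
      sup_le (fixingSubgroup_le_stabilizer_ofLayer M y) fun τ hτ => hz τ hτ
    exact hle hσ'

/-! ## §2. `C_{K_S} = C̄^{N_S}` as a representation of `G_S`, and its discreteness -/

variable (K) in
/-- **`C_{K_S} := C̄^{N_S}`**, the `N_S`-invariants of the discrete `Γ_K`-module `C̄ = lim→ C_E` with the induced action of
`G_S = Γ_K ⧸ N_S` (door-c4's `invariantsQuotFunctor`; `= ⋃_{E ⊆ K_S} C_E = lim→_{F ⊆ K_S} C_F` by `exists_toKS`).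
[cite: MilneADT2006, I §4 (p. 55)][cite: Harari2020, §17.1 Thm. 17.2 (proof)] -/
abbrev classBarKS : Rep ℤ (GaloisGroupUnramifiedOutside K (↑S : Set (HeightOneSpectrum (𝓞 K)))) :=
  (DiscreteRep.invariantsQuotFunctor ℤ (ramificationSubgroup K (↑S : Set (HeightOneSpectrum (𝓞 K))))).obj (classBarD K)

/-- Membership in `C_{K_S} = C̄^{N_S}`: fixed by `N_S`. [cite: Harari2020, §17.1 Thm. 17.2 (proof)] -/
theorem mem_invariantsKS_iff_forall (z : classBar K) :
    z ∈ Representation.invariants ((classBarRep K).ρ.comp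
        (ramificationSubgroup K (↑S : Set (HeightOneSpectrum (𝓞 K)))).subtype) ↔
      ∀ σ ∈ ramificationSubgroup K (↑S : Set (HeightOneSpectrum (𝓞 K))), barRep K σ z = z := by
  rw [Representation.mem_invariants]
  exact ⟨fun h σ hσ => h ⟨σ, hσ⟩, fun h g => h g.1 g.2⟩

/-- **`C̄^{N_S} = ⋃_{E ⊆ K_S} C_E`**: an element of `C̄` is fixed by `N_S` iff it comes from a layer inside `K_S`.
[cite: MilneADT2006, I §4 (p. 55)][cite: NeukirchSchmidtWingberg2008, VIII §3 (8.3.7)] -/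
theorem mem_invariantsKS_iff (z : classBar K) :
    z ∈ Representation.invariants ((classBarRep K).ρ.comp
        (ramificationSubgroup K (↑S : Set (HeightOneSpectrum (𝓞 K)))).subtype) ↔
      ∃ (E : GalLayer K) (_ : ramificationSubgroup K (↑S : Set (HeightOneSpectrum (𝓞 K))) ≤ galFixing K E.1)
        (x : layerClass K E), ofLayer K E x = z := by
  rw [mem_invariantsKS_iff_forall]
  constructor
  · exact exists_layer_insideKS_of_forall_mem S z
  · rintro ⟨E, hE, x, rfl⟩ σ hσ
    exact barRep_ofLayer_of_mem_ramificationSubgroup S hE hσ x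

/-- The underlying vector of `[σ] • z` in `C_{K_S}` is `σ • z` (definitional). [cite: Harari2020, §17.1 Thm. 17.2 (proof)] -/
theorem coe_classBarKS_ρ_mk (σ : absoluteGaloisGroup K) (z : (classBarKS K S).V) :
    (((classBarKS K S).ρ (QuotientGroup.mk σ) z).1 : classBar K) = barRep K σ (z.1 : classBar K) := rfl

/-- **`C_E → C_{K_S}`, `x ↦ [x]_E`**, for a layer `E ⊆ K_S`. [cite: MilneADT2006, I §4 (p. 55)] -/
def toKS {E : GalLayer K} (hE : ramificationSubgroup K (↑S : Set (HeightOneSpectrum (𝓞 K))) ≤ galFixing K E.1) :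
    layerClass K E →+ (classBarKS K S).V :=
  AddMonoidHom.mk' (fun x => ⟨ofLayer K E x, (mem_invariantsKS_iff S _).2 ⟨E, hE, x, rfl⟩⟩) fun x y =>
    Subtype.ext (map_add (ofLayer K E) x y)

/-- Formula: `(toKS hE x : C̄) = [x]_E`. [cite: MilneADT2006, I §4 (p. 55)] -/
@[simp] theorem coe_toKS {E : GalLayer K}
    (hE : ramificationSubgroup K (↑S : Set (HeightOneSpectrum (𝓞 K))) ≤ galFixing K E.1) (x : layerClass K E) :
    ((toKS S hE x).1 : classBar K) = ofLayer K E x := rfl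

/-- `C_E → C_{K_S}` is injective. [cite: MilneADT2006, I §4 (p. 55)] -/
theorem toKS_injective {E : GalLayer K}
    (hE : ramificationSubgroup K (↑S : Set (HeightOneSpectrum (𝓞 K))) ≤ galFixing K E.1) :
    Function.Injective (toKS S hE) :=
  fun _ _ h => ofLayer_injective E (congrArg Subtype.val h)

/-- `C_E → C_{E'} → C_{K_S}` is `C_E → C_{K_S}` for layers `E ≤ E'` inside `K_S`. [cite: MilneADT2006, I §4 (p. 55)] -/
theorem toKS_transHom {E E' : GalLayer K} (h : E ≤ E')
    (hE : ramificationSubgroup K (↑S : Set (HeightOneSpectrum (𝓞 K))) ≤ galFixing K E.1)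
    (hE' : ramificationSubgroup K (↑S : Set (HeightOneSpectrum (𝓞 K))) ≤ galFixing K E'.1) (x : layerClass K E) :
    toKS S hE' (transHom E E' h x) = toKS S hE x :=
  Subtype.ext (ofLayer_transHom h x)

/-- **Every element of `C_{K_S}` comes from a layer inside `K_S`** (`C_{K_S} = lim→_{F ⊆ K_S} C_F`).
[cite: MilneADT2006, I §4 (p. 55)][cite: NeukirchSchmidtWingberg2008, VIII §3 (8.3.7)] -/
theorem exists_toKS (z : (classBarKS K S).V) :
    ∃ (E : GalLayer K) (hE : ramificationSubgroup K (↑S : Set (HeightOneSpectrum (𝓞 K))) ≤ galFixing K E.1)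
      (x : layerClass K E), toKS S hE x = z := by
  obtain ⟨E, hE, x, hx⟩ := (mem_invariantsKS_iff S z.1).1 z.2
  exact ⟨E, hE, x, Subtype.ext hx⟩

/-- **`[σ] • [x]_E = [σ|_E • x]_E` in `C_{K_S}`** (`G_S` acts on the layer `C_E` through `Gal(E/K)`).
[cite: Harari2020, §17.1 Thm. 17.2 (proof)] -/
theorem classBarKS_ρ_mk_toKS (σ : absoluteGaloisGroup K) {E : GalLayer K}
    (hE : ramificationSubgroup K (↑S : Set (HeightOneSpectrum (𝓞 K))) ≤ galFixing K E.1) (x : layerClass K E) :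
    (classBarKS K S).ρ (QuotientGroup.mk σ) (toKS S hE x) = toKS S hE (layerAct K E σ x) :=
  Subtype.ext (barRep_ofLayer σ E x)

/-- **`Gal(K_S/E)` fixes the image of `C_E` in `C_{K_S}`**: `[σ] • [x]_E = [x]_E` for `σ ∈ Gal(K̄/E)`.
[cite: Harari2020, §17.1 Thm. 17.2 (proof)][cite: NeukirchSchmidtWingberg2008, VIII §3 (8.3.7)] -/
theorem classBarKS_ρ_mk_toKS_of_mem {E : GalLayer K}
    (hE : ramificationSubgroup K (↑S : Set (HeightOneSpectrum (𝓞 K))) ≤ galFixing K E.1)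
    {σ : absoluteGaloisGroup K} (hσ : σ ∈ galFixing K E.1) (x : layerClass K E) :
    (classBarKS K S).ρ (QuotientGroup.mk σ) (toKS S hE x) = toKS S hE x :=
  Subtype.ext (barRep_ofLayer_of_mem_fixingSubgroup E hσ x)

omit [NumberField K] in
/-- The image `Gal(K_S/E) = U_E N_S / N_S` of `Gal(K̄/E)` in `G_S` is open (`Γ_K → G_S` is an open map).
[cite: NeukirchSchmidtWingberg2008, VIII §3] -/
theorem isOpen_map_galFixing (E : GalLayer K) :
    IsOpen (((galFixing K E.1).map (QuotientGroup.mk' (ramificationSubgroup K (↑S : Set (HeightOneSpectrum (𝓞 K))))) :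
        Subgroup (GaloisGroupUnramifiedOutside K (↑S : Set (HeightOneSpectrum (𝓞 K))))) :
      Set (GaloisGroupUnramifiedOutside K (↑S : Set (HeightOneSpectrum (𝓞 K))))) := by
  haveI := E.finiteDimensional
  exact isOpenMap_toUnramifiedQuot K _ _ (isOpen_galFixing K E.1)

/-- The stabiliser of `[x]_E ∈ C_{K_S}` contains the open subgroup `Gal(K_S/E)`. [cite: Harari2020, §4.2 and §17.1] -/
theorem map_galFixing_le_stabilizer_toKS {E : GalLayer K}
    (hE : ramificationSubgroup K (↑S : Set (HeightOneSpectrum (𝓞 K))) ≤ galFixing K E.1) (x : layerClass K E) :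
    (galFixing K E.1).map (QuotientGroup.mk' (ramificationSubgroup K (↑S : Set (HeightOneSpectrum (𝓞 K))))) ≤
      DiscreteRep.stabilizer (classBarKS K S) (toKS S hE x) := by
  rintro _ ⟨σ, hσ, rfl⟩
  exact classBarKS_ρ_mk_toKS_of_mem S hE hσ x

/-- **`C_{K_S}` is a discrete `G_S`-module** (every element comes from a layer `E ⊆ K_S` and is fixed by the open subgroup
`Gal(K_S/E)`). [cite: Harari2020, §4.2 Remark 4.13 and §17.1][cite: MilneADT2006, I §4] -/
theorem isDiscrete_classBarKS : DiscreteRep.IsDiscrete (classBarKS K S) := fun z => by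
  obtain ⟨E, hE, x, rfl⟩ := exists_toKS S z
  exact Subgroup.isOpen_mono (map_galFixing_le_stabilizer_toKS S hE x) (isOpen_map_galFixing S E)

variable (K) in
/-- **`C_{K_S}` as an object of `C_{G_S} = DiscreteRepCat ℤ G_S`.** [cite: Harari2020, §4.2 and §17.1][cite: MilneADT2006, I §4] -/
abbrev classBarKSD : DiscreteRepCat ℤ (GaloisGroupUnramifiedOutside K (↑S : Set (HeightOneSpectrum (𝓞 K)))) :=
  DiscreteRep.mk (classBarKS K S) (isDiscrete_classBarKS S)

end IdeleClassBar

end Literature.NumberTheory.GaloisRepresentations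

end
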